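import Summits.HodgeConjecture.CorCM.Census.CyclicBoundaryWindows

/-!
# Boundary sets of cyclic CM types, Ib: the window count under a slide

COR-CM (cell `pub-hodgecm2`), count-neutral kernel combinatorics by the binder seat b23 (gen 38; lane CYCLIC-FACES, part Ib, sequel of
`Census/CyclicBoundaryWindows.lean` (`gap`, `lgap`, `zeroWindows`, `W`, `pot`)).  Pure combinatorics of finite subsets of `ℤ/n`; one
theorems only (the reflected set `T.image (−·)` and the translated set `T.image (· + a)` are written inline); no certificate, no `decide` table, no named fact, no geometry, no `sorry`.
HONEST FRAMING: `HC_CM` is NOT proved, here or anywhere in the tree; nothing here is a period or a headline.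

CONTENT.
* `through_iff`: a window `(x; x+1, …, x+k)` (`k < n`) passes through `y` iff `(y − x).val ≤ k` — the decidable form used to split
  the zero windows of `T` into those through / away from a point;
* **`W_slide_right`** (THE SLIDE LEMMA): for `t ∈ T` and `|T| ≥ 2`: `W (T − t + (t+1)) + gap T t = W T + lgap T t + 1` — sliding a member
  one step into its right gap trades the `gap − 1` zero windows starting at `t + 1` (`filter_through_succ_eq`) for the `lgap` zero windows
  ending at `t` (`filter_through_eq`), all other zero windows being the same (`filter_away_eq`);
* the reflection `x ↦ −x` (`W_neg`, `gap_neg`, `lgap_neg`) and the mirror **`W_slide_left`**: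
  `W (T − t + (t−1)) + lgap T t = W T + gap T t + 1`;
* the translation `T + a` (`W_shift`, `pot_shift`): the potential is rotation invariant (base change of the type).
All [folklore] (elementary counting).

## References
* [Pohlmann1968] H. Pohlmann, Algebraic cycles on abelian varieties of complex multiplication type, Ann. of Math. 88 (1968), Thm 1.
-/

namespace Summit.HodgeConjecture.CorCM.Census.CyclicBoundary

open Finset

variable {n : ℕ} [NeZero n]

/-! ## §1 The window count under a slide to the right -/

section Slide

variable {T : Finset (ZMod n)} {t : ZMod n}

omit [NeZero n] in
/-- **A window passes through `y`** iff `y − x` is an offset `≤ k`: `(y − x).val ≤ k ↔ ∃ e ≤ k, x + e = y` (for `k < n`). [folklore] -/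
theorem through_iff [NeZero n] {x y : ZMod n} {k : ℕ} (hk : k < n) :
    (y - x).val ≤ k ↔ ∃ e : ℕ, e ≤ k ∧ x + (e : ZMod n) = y := by
  constructor
  · intro h
    exact ⟨(y - x).val, h, by rw [ZMod.natCast_zmod_val, add_sub_cancel]⟩
  · rintro ⟨e, he, hxe⟩
    have hyx : y - x = (e : ZMod n) := by rw [← hxe, add_sub_cancel_left]
    rw [hyx, ZMod.val_cast_of_lt (lt_of_le_of_lt he hk)]
    exact he

/-- The zero windows of `T` away from `t + 1` are the zero windows of `T − t + (t+1)` away from `t`. [folklore] -/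
theorem filter_away_eq (ht : t ∈ T) :
    (zeroWindows T).filter (fun w : ZMod n × ℕ => ¬ (t + 1 - w.1).val ≤ w.2) =
      (zeroWindows (insert (t + 1) (T.erase t))).filter (fun w : ZMod n × ℕ => ¬ (t - w.1).val ≤ w.2) := by
  ext ⟨x, k⟩
  simp only [Finset.mem_filter, mem_zeroWindows, Finset.mem_insert, Finset.mem_erase, not_or, not_and]
  constructor
  · rintro ⟨⟨hk, hz⟩, hne⟩
    rw [through_iff hk, not_exists] at hne
    refine ⟨⟨hk, fun e he => ⟨fun h => hne e ⟨he, h⟩, fun _ => hz e he⟩⟩, ?_⟩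
    rw [through_iff hk, not_exists]
    rintro e ⟨he, hxe⟩
    exact hz e he (by rw [hxe]; exact ht)
  · rintro ⟨⟨hk, hz⟩, hne⟩
    rw [through_iff hk, not_exists] at hne
    refine ⟨⟨hk, fun e he hmem => (hz e he).2 (fun h => hne e ⟨he, h⟩) hmem⟩, ?_⟩
    rw [through_iff hk, not_exists]
    rintro e ⟨he, hxe⟩
    exact (hz e he).1 hxe

/-- **The zero windows of `T` through `t + 1`** (`t ∈ T`): exactly the `gap T t − 1` windows starting at `t + 1`. [folklore] -/
theorem filter_through_succ_eq (ht : t ∈ T) :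
    (zeroWindows T).filter (fun w : ZMod n × ℕ => (t + 1 - w.1).val ≤ w.2) =
      (Finset.range (gap T t - 1)).image fun k : ℕ => (t + 1, k) := by
  have hg := gap_spec ht
  ext ⟨x, k⟩
  simp only [Finset.mem_filter, mem_zeroWindows, Finset.mem_range, Finset.mem_image, Prod.mk.injEq]
  constructor
  · rintro ⟨⟨hk, hz⟩, hth⟩
    obtain ⟨e, he, hxe⟩ := (through_iff hk).mp hth
    -- the window starts at `t + 1`
    have he0 : e = 0 := by
      by_contra hne
      have h1 : 1 ≤ e := Nat.one_le_iff_ne_zero.mpr hne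
      have hpt : x + ((e - 1 : ℕ) : ZMod n) = t := by
        have : x + ((e - 1 : ℕ) : ZMod n) + 1 = t + 1 := by
          rw [← hxe, Nat.cast_sub h1, Nat.cast_one]; ring
        exact add_right_cancel this
      exact hz (e - 1) (by omega) (by rw [hpt]; exact ht)
    subst he0
    rw [Nat.cast_zero, add_zero] at hxe
    subst hxe
    refine ⟨k, ?_, rfl, rfl⟩
    -- the window ends before `t + gap`
    by_contra hge
    push Not at hge
    have hpt : t + 1 + ((gap T t - 1 : ℕ) : ZMod n) = t + (gap T t : ZMod n) := by
      rw [Nat.cast_sub hg.1, Nat.cast_one]; ring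
    exact hz (gap T t - 1) hge (by rw [hpt]; exact hg.2.2)
  · rintro ⟨k', hk', hx, hkk⟩
    rw [← hkk]
    subst hx
    refine ⟨⟨by omega, fun e he => ?_⟩, (through_iff (by omega)).mpr ⟨0, Nat.zero_le _, by rw [Nat.cast_zero, add_zero]⟩⟩
    have hpt : t + 1 + (e : ZMod n) = t + ((e + 1 : ℕ) : ZMod n) := by push_cast; ring
    rw [hpt]
    exact not_mem_of_lt_gap (by omega) (by omega)

/-- **The zero windows of `T − t + (t+1)` through `t`** (`t ∈ T`, `|T| ≥ 2`): exactly the `lgap T t` windows ending at `t`. [folklore] -/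
theorem filter_through_eq (h2 : 2 ≤ T.card) (ht : t ∈ T) :
    (zeroWindows (insert (t + 1) (T.erase t))).filter (fun w : ZMod n × ℕ => (t - w.1).val ≤ w.2) =
      (Finset.range (lgap T t)).image fun k : ℕ => (t - (k : ZMod n), k) := by
  have hl := lgap_spec ht
  have hln := lgap_lt_of_two_le h2 (t := t)
  ext ⟨x, k⟩
  simp only [Finset.mem_filter, mem_zeroWindows, Finset.mem_range, Finset.mem_image, Prod.mk.injEq,
    Finset.mem_insert, Finset.mem_erase, not_or, not_and]
  constructor
  · rintro ⟨⟨hk, hz⟩, hth⟩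
    obtain ⟨e, he, hxe⟩ := (through_iff hk).mp hth
    -- the window ends at `t`
    have hek : e = k := by
      by_contra hne
      have hpt : x + ((e + 1 : ℕ) : ZMod n) = t + 1 := by rw [← hxe]; push_cast; ring
      exact (hz (e + 1) (by omega)).1 hpt
    rw [hek] at hxe
    have hx : x = t - (k : ZMod n) := by rw [← hxe]; ring
    refine ⟨k, ?_, hx.symm, rfl⟩
    -- the window starts after `t − lgap`
    by_contra hge
    push Not at hge
    have hpt : x + ((k - lgap T t : ℕ) : ZMod n) = t - (lgap T t : ZMod n) := by
      rw [hx, Nat.cast_sub hge]; ring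
    have hne : t - (lgap T t : ZMod n) ≠ t := by
      intro h
      have h0 : (lgap T t : ZMod n) = 0 := by
        have := congrArg (fun y => t - y) h
        simpa using this
      have := Nat.eq_zero_of_dvd_of_lt ((ZMod.natCast_eq_zero_iff _ _).mp h0) hln
      omega
    have key := (hz (k - lgap T t) (by omega)).2
    rw [hpt] at key
    exact key hne hl.2.2
  · rintro ⟨k', hk', hx, hkk⟩
    rw [← hkk]
    subst hx
    refine ⟨⟨by omega, fun e he => ⟨?_, fun hne => ?_⟩⟩, (through_iff (by omega)).mpr ⟨k', le_rfl, by ring⟩⟩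
    · -- no point of the window is `t + 1`
      intro h
      have h0 : ((k' - e + 1 : ℕ) : ZMod n) = 0 := by
        have : t - (k' : ZMod n) + (e : ZMod n) + ((k' - e + 1 : ℕ) : ZMod n) = t + 1 := by
          rw [Nat.cast_add, Nat.cast_sub he, Nat.cast_one]; ring
        rw [h] at this
        simpa using this
      have := Nat.eq_zero_of_dvd_of_lt ((ZMod.natCast_eq_zero_iff _ _).mp h0) (by omega)
      omega
    · -- the other points avoid `T`
      have hpt : t - (k' : ZMod n) + (e : ZMod n) = t - ((k' - e : ℕ) : ZMod n) := by
        rw [Nat.cast_sub he]; ring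
      rw [hpt] at hne ⊢
      have hke : 1 ≤ k' - e := by
        by_contra h0
        push Not at h0
        have : k' - e = 0 := by omega
        rw [this, Nat.cast_zero, sub_zero] at hne
        exact hne rfl
      exact not_mem_of_lt_lgap hke (by omega)

/-- **THE SLIDE LEMMA (to the right).**  For `t ∈ T` and `|T| ≥ 2` (typically `t + 1 ∉ T`):
`W (T − t + (t+1)) + gap T t = W T + lgap T t + 1`. [folklore] -/
theorem W_slide_right (h2 : 2 ≤ T.card) (ht : t ∈ T) :
    W (insert (t + 1) (T.erase t)) + gap T t = W T + lgap T t + 1 := by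
  have hg := gap_spec ht
  have hA := Finset.card_filter_add_card_filter_not (s := zeroWindows T)
    (fun w : ZMod n × ℕ => (t + 1 - w.1).val ≤ w.2)
  have hA' := Finset.card_filter_add_card_filter_not (s := zeroWindows (insert (t + 1) (T.erase t)))
    (fun w : ZMod n × ℕ => (t - w.1).val ≤ w.2)
  rw [filter_through_succ_eq ht, Finset.card_image_of_injective _ (fun a b h => (Prod.ext_iff.mp h).2),
    Finset.card_range, filter_away_eq ht] at hA
  rw [filter_through_eq h2 ht, Finset.card_image_of_injective _ (fun a b h => (Prod.ext_iff.mp h).2),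
    Finset.card_range] at hA'
  unfold W
  omega

end Slide

/-! ## §2 Reflection and the slide to the left -/

section Reflect

omit [NeZero n] in
/-- Membership in `−T`. [folklore] -/
theorem mem_neg {T : Finset (ZMod n)} {x : ZMod n} : x ∈ T.image (fun y => -y) ↔ -x ∈ T := by
  rw [Finset.mem_image]
  constructor
  · rintro ⟨y, hy, rfl⟩; rwa [neg_neg]
  · intro h; exact ⟨-x, h, neg_neg x⟩

omit [NeZero n] in
/-- `|−T| = |T|`. [folklore] -/
theorem card_neg (T : Finset (ZMod n)) : (T.image (fun y => -y)).card = T.card :=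
  Finset.card_image_of_injective _ neg_injective

omit [NeZero n] in
/-- `−(−T) = T`. [folklore] -/
theorem neg_neg_eq (T : Finset (ZMod n)) : (T.image (fun y => -y)).image (fun y => -y) = T := by
  ext x; rw [mem_neg, mem_neg, neg_neg]

omit [NeZero n] in
/-- **The right gap of `−t` in `−T` is the left gap of `t` in `T`.** [folklore] -/
theorem gap_neg (T : Finset (ZMod n)) (t : ZMod n) : gap (T.image (fun y => -y)) (-t) = lgap T t := by
  have key : ∀ d : ℕ, (-t + (d : ZMod n) ∈ T.image (fun y => -y)) ↔ (t - (d : ZMod n) ∈ T) := by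
    intro d; rw [mem_neg, neg_add, neg_neg, sub_eq_add_neg]
  by_cases h : ∃ d : ℕ, 1 ≤ d ∧ t - (d : ZMod n) ∈ T
  · have h' : ∃ d : ℕ, 1 ≤ d ∧ -t + (d : ZMod n) ∈ T.image (fun y => -y) := by
      obtain ⟨d, hd, hm⟩ := h; exact ⟨d, hd, (key d).mpr hm⟩
    have e1 : gap (T.image (fun y => -y)) (-t) = Nat.find h' := by unfold gap; rw [dif_pos h']
    have e2 : lgap T t = Nat.find h := by unfold lgap; rw [dif_pos h]
    rw [e1, e2]
    refine le_antisymm ?_ ?_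
    · exact Nat.find_le ⟨(Nat.find_spec h).1, (key _).mpr (Nat.find_spec h).2⟩
    · exact Nat.find_le ⟨(Nat.find_spec h').1, (key _).mp (Nat.find_spec h').2⟩
  · have h' : ¬ ∃ d : ℕ, 1 ≤ d ∧ -t + (d : ZMod n) ∈ T.image (fun y => -y) := by
      rintro ⟨d, hd, hm⟩; exact h ⟨d, hd, (key d).mp hm⟩
    have e1 : gap (T.image (fun y => -y)) (-t) = 0 := by unfold gap; rw [dif_neg h']
    have e2 : lgap T t = 0 := by unfold lgap; rw [dif_neg h]
    rw [e1, e2]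

omit [NeZero n] in
/-- **The left gap of `−t` in `−T` is the right gap of `t` in `T`.** [folklore] -/
theorem lgap_neg (T : Finset (ZMod n)) (t : ZMod n) : lgap (T.image (fun y => -y)) (-t) = gap T t := by
  have h := gap_neg (T.image (fun y => -y)) (-t)
  rw [neg_neg_eq, neg_neg] at h
  exact h.symm

/-- **The window count is reflection invariant** (`(x; …, x+k) ↦ (−x−k; …, −x)`). [folklore] -/
theorem W_neg (T : Finset (ZMod n)) : W (T.image (fun y => -y)) = W T := by
  unfold W
  refine Finset.card_bij (fun w _ => (-w.1 - (w.2 : ZMod n), w.2)) ?_ ?_ ?_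
  · rintro ⟨x, k⟩ hw
    dsimp only
    rw [mem_zeroWindows] at hw ⊢
    refine ⟨hw.1, fun e he hmem => ?_⟩
    have hpt : -x - (k : ZMod n) + (e : ZMod n) = -(x + ((k - e : ℕ) : ZMod n)) := by
      rw [Nat.cast_sub he]; ring
    rw [hpt, ← mem_neg] at hmem
    exact hw.2 (k - e) (by omega) hmem
  · rintro ⟨x, k⟩ _ ⟨x', k'⟩ _ h
    dsimp only at h
    simp only [Prod.mk.injEq] at h
    obtain ⟨h1, rfl⟩ := h
    have hx : x = x' := by
      have := congrArg (fun y => -(y + (k : ZMod n))) h1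
      simpa using this
    rw [hx]
  · rintro ⟨x, k⟩ hw
    refine ⟨(-x - (k : ZMod n), k), ?_, Prod.ext (by dsimp only; ring) rfl⟩
    rw [mem_zeroWindows] at hw ⊢
    refine ⟨hw.1, fun e he hmem => ?_⟩
    rw [mem_neg] at hmem
    have hpt : -(-x - (k : ZMod n) + (e : ZMod n)) = x + ((k - e : ℕ) : ZMod n) := by
      rw [Nat.cast_sub he]; ring
    rw [hpt] at hmem
    exact hw.2 (k - e) (by omega) hmem

omit [NeZero n] in
/-- Reflection of `T − t + (t−1)`. [folklore] -/
theorem neg_insert_erase (T : Finset (ZMod n)) (t : ZMod n) :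
    (insert (t - 1) (T.erase t)).image (fun y => -y) = insert (-t + 1) ((T.image (fun y => -y)).erase (-t)) := by
  ext x
  rw [mem_neg, Finset.mem_insert, Finset.mem_erase, Finset.mem_insert, Finset.mem_erase, mem_neg]
  have e1 : (-x = t - 1) ↔ (x = -t + 1) := by
    constructor
    · intro h; linear_combination -h
    · intro h; linear_combination -h
  have e2 : (-x ≠ t) ↔ (x ≠ -t) := not_congr neg_eq_iff_eq_neg
  rw [e1, e2]

/-- **THE SLIDE LEMMA (to the left).**  For `t ∈ T` with `t − 1 ∉ T` and `|T| ≥ 2`: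
`W (T − t + (t−1)) + lgap T t = W T + gap T t + 1`. [folklore] -/
theorem W_slide_left {T : Finset (ZMod n)} {t : ZMod n} (h2 : 2 ≤ T.card) (ht : t ∈ T) :
    W (insert (t - 1) (T.erase t)) + lgap T t = W T + gap T t + 1 := by
  have ht' : -t ∈ T.image (fun y => -y) := by rw [mem_neg, neg_neg]; exact ht
  have h := W_slide_right (T := T.image (fun y => -y)) (by rw [card_neg]; exact h2) ht'
  rw [gap_neg, lgap_neg, ← neg_insert_erase, W_neg, W_neg] at h
  exact h

end Reflect

/-! ## §3 Translation -/

section Shift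

omit [NeZero n] in
/-- Membership in `T + a`. [folklore] -/
theorem mem_shift {T : Finset (ZMod n)} {a x : ZMod n} : x ∈ T.image (fun y => y + a) ↔ x - a ∈ T := by
  rw [Finset.mem_image]
  constructor
  · rintro ⟨y, hy, rfl⟩; rwa [add_sub_cancel_right]
  · intro h; exact ⟨x - a, h, sub_add_cancel x a⟩

omit [NeZero n] in
/-- `|T + a| = |T|`. [folklore] -/
theorem card_shift (T : Finset (ZMod n)) (a : ZMod n) : (T.image (fun y => y + a)).card = T.card :=
  Finset.card_image_of_injective _ (add_left_injective a)

/-- **The window count is translation invariant.** [folklore] -/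
theorem W_shift (T : Finset (ZMod n)) (a : ZMod n) : W (T.image (fun y => y + a)) = W T := by
  unfold W
  refine Finset.card_bij (fun w _ => (w.1 - a, w.2)) ?_ ?_ ?_
  · rintro ⟨x, k⟩ hw
    dsimp only
    rw [mem_zeroWindows] at hw ⊢
    refine ⟨hw.1, fun e he hmem => hw.2 e he ?_⟩
    rw [mem_shift]
    have hpt : x + (e : ZMod n) - a = x - a + (e : ZMod n) := by ring
    rw [hpt]; exact hmem
  · rintro ⟨x, k⟩ _ ⟨x', k'⟩ _ h
    dsimp only at h
    simp only [Prod.mk.injEq] at h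
    obtain ⟨h1, rfl⟩ := h
    rw [sub_left_inj.mp h1]
  · rintro ⟨x, k⟩ hw
    refine ⟨(x + a, k), ?_, Prod.ext (by dsimp only; ring) rfl⟩
    rw [mem_zeroWindows] at hw ⊢
    refine ⟨hw.1, fun e he hmem => hw.2 e he ?_⟩
    rw [mem_shift] at hmem
    have hpt : x + a + (e : ZMod n) - a = x + (e : ZMod n) := by ring
    rw [hpt] at hmem; exact hmem

/-- **The potential is translation invariant.** [folklore] -/
theorem pot_shift (T : Finset (ZMod n)) (a : ZMod n) : pot (T.image (fun y => y + a)) = pot T := by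
  unfold pot; rw [card_shift, W_shift]

end Shift

end Summit.HodgeConjecture.CorCM.Census.CyclicBoundary
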